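import Mathlib
import Literature.Probability.LatticeModels.ProdBernoulliIndependence
import Literature.Probability.Percolation.ConditionalPositiveAssociation
import Literature.Probability.Percolation.TwoClusterConditionalAssociation
import Literature.Probability.Percolation.PercolationProofs
import Literature.Probability.Percolation.ClusterBoundary
import HarnessLib

/-!
# The single-finger lemma: `stub_singleFinger`

This file proves `stub_singleFinger`.

**Single-finger lemma** (Kozma–Nitzan, arXiv:2401.12397, Lemma 2 with singleton blocks).  On the
finite weighted graph `(Fin n, w)` with `μ = prodBernoulli w`: if every `a ∈ A'` has
`μ(a ↮ b) ≤ t`, then `μ{exactly one point of A' is joined to o, and o ↮ b} ≤ t` — with no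
factor `|A'|`.  Proof: on that event the unique finger `a` satisfies `o ↔ a` and `a ↮ x` for every
other point `x` of the ground set `G = insert b A'` (cover, `singleFinger_subset_biUnion`); the
terminal-separation hypothesis (BHK two-cluster conditional association in vertex-set form) gives
`μ(o ↔ a, a ↮ G∖a) · μ(M) ≤ μ(a ↮ G∖a) · μ(o ↔ a, M) ≤ t · μ(o ↔ a, M)` where `M` is the event
that `G` is pairwise separated; the events `{o ↔ a} ∩ M` are pairwise disjoint, so summing over
`a` and dividing by `μ(M) > 0` gives the bound (`singleFinger_le_of_pairSep_pos`).  The case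
`μ(M) = 0` (weight-one edges) is removed by scaling the weights by `1 - 1/(k+1)` and passing to
the limit `k → ∞` with the weight-continuity hypothesis.
-/

namespace Summit.CriticalPhenomena.PercolationContinuityZ3.Theorems

open scoped BigOperators Classical Topology
open MeasureTheory Set Filter
open Literature.Probability.LatticeModels (prodBernoulli prodBernoulli_real_forall_notMem)
open Literature.Probability.Percolation (openConn openGraph measurableSet_openConn_holds)

/-- **Cover.** If exactly one point `a` of `A'` is joined to `o` and `o ↮ b`, then `a ≠ b`,
`o ↔ a`, and `a` is joined to no other point of the ground set `insert b A'`. -/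
theorem singleFinger_subset_biUnion {n : ℕ} (A' : Finset (Fin n)) (o b : Fin n) :
    {ω : Set (Sym2 (Fin n)) |
        (A'.filter fun a => ω ∈ openConn o a).card = 1 ∧ ω ∉ openConn o b} ⊆
      ⋃ a ∈ A'.filter (· ≠ b),
        (openConn o a ∩ {ω | ∀ t ∈ (insert b A').erase a, ω ∉ openConn a t}) := by
  rintro ω ⟨hcard, hob⟩
  obtain ⟨a, ha⟩ := Finset.card_eq_one.1 hcard
  have haf : a ∈ A'.filter fun a => ω ∈ openConn o a := by
    rw [ha]; exact Finset.mem_singleton_self a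
  obtain ⟨haA, hoa⟩ := Finset.mem_filter.1 haf
  have hoa' : (openGraph ω).Reachable o a := hoa
  have hab : a ≠ b := by
    rintro rfl
    exact hob hoa
  refine Set.mem_iUnion₂.2 ⟨a, Finset.mem_filter.2 ⟨haA, hab⟩, hoa, ?_⟩
  intro x hx hax
  have hax' : (openGraph ω).Reachable a x := hax
  obtain ⟨hxa, hxG⟩ := Finset.mem_erase.1 hx
  rcases Finset.mem_insert.1 hxG with rfl | hxA
  · exact hob (hoa'.trans hax')
  · have hxf : x ∈ A'.filter fun a => ω ∈ openConn o a :=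
      Finset.mem_filter.2 ⟨hxA, hoa'.trans hax'⟩
    rw [ha] at hxf
    exact hxa (Finset.mem_singleton.1 hxf)

/-- For `a ∈ G`: (`a` is separated from `G ∖ {a}`) and (`G ∖ {a}` is pairwise separated) iff
`G` is pairwise separated. -/
theorem singleFinger_sep_inter_pairSep_eq {n : ℕ} (G : Finset (Fin n)) {a : Fin n} (ha : a ∈ G) :
    ({ω : Set (Sym2 (Fin n)) | ∀ t ∈ G.erase a, ω ∉ openConn a t} ∩
        {ω | ∀ t ∈ G.erase a, ∀ t' ∈ G.erase a, t ≠ t' → ω ∉ openConn t t'}) =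
      {ω | ∀ x ∈ G, ∀ y ∈ G, x ≠ y → ω ∉ openConn x y} := by
  ext ω
  simp only [Set.mem_inter_iff, Set.mem_setOf_eq]
  constructor
  · rintro ⟨hD, hQ⟩ x hx y hy hxy
    by_cases hxa : x = a
    · rw [hxa]
      exact hD y (Finset.mem_erase.2 ⟨fun h => hxy (hxa.trans h.symm), hy⟩)
    · by_cases hya : y = a
      · rw [hya]
        intro h
        have h' : (openGraph ω).Reachable x a := h
        exact hD x (Finset.mem_erase.2 ⟨hxa, hx⟩) h'.symm
      · exact hQ x (Finset.mem_erase.2 ⟨hxa, hx⟩) y (Finset.mem_erase.2 ⟨hya, hy⟩) hxy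
  · intro hM
    refine ⟨fun x hx => ?_, fun x hx y hy hxy => ?_⟩
    · obtain ⟨hxa, hxG⟩ := Finset.mem_erase.1 hx
      exact hM a ha x hxG (Ne.symm hxa)
    · exact hM x (Finset.mem_of_mem_erase hx) y (Finset.mem_of_mem_erase hy) hxy

/-- The events `{o ↔ a} ∩ {G pairwise separated}`, `a ∈ A'' ⊆ G`, are pairwise disjoint
(two fingers `a ≠ a'` joined to `o` would be joined to each other). -/
theorem singleFinger_pairwiseDisjoint_conn_inter_pairSep {n : ℕ} (G A'' : Finset (Fin n))
    (o : Fin n) (hA'' : A'' ⊆ G) :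
    (↑A'' : Set (Fin n)).PairwiseDisjoint fun a =>
      openConn o a ∩ {ω : Set (Sym2 (Fin n)) | ∀ x ∈ G, ∀ y ∈ G, x ≠ y → ω ∉ openConn x y} := by
  intro a ha a' ha' hne
  simp only [Function.onFun]
  refine Set.disjoint_left.2 fun ω hω hω' => ?_
  have hoa : (openGraph ω).Reachable o a := hω.1
  have hoa' : (openGraph ω).Reachable o a' := hω'.1
  exact hω.2 a (hA'' (Finset.mem_coe.1 ha)) a' (hA'' (Finset.mem_coe.1 ha')) hne
    (hoa.symm.trans hoa')

/-- If every weight is `< 1`, the event that a vertex set is pairwise separated has positive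
probability: it contains the empty configuration, of probability `∏ₑ (1 - w e) > 0`. -/
theorem singleFinger_pairSep_real_pos {n : ℕ} (w : Sym2 (Fin n) → unitInterval)
    (hw : ∀ e, (w e : ℝ) < 1) (G : Finset (Fin n)) :
    0 < (prodBernoulli w).real
      {ω : Set (Sym2 (Fin n)) | ∀ x ∈ G, ∀ y ∈ G, x ≠ y → ω ∉ openConn x y} := by
  have hsub : {ω : Set (Sym2 (Fin n)) | ∀ e ∈ (Finset.univ : Finset (Sym2 (Fin n))), e ∉ ω} ⊆
      {ω | ∀ x ∈ G, ∀ y ∈ G, x ≠ y → ω ∉ openConn x y} := by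
    intro ω hω x _ y _ hxy hconn
    have hempty : ω = ∅ :=
      Set.eq_empty_iff_forall_notMem.2 fun e he => hω e (Finset.mem_univ e) he
    have hbot : openGraph ω = ⊥ := by
      rw [hempty]; exact SimpleGraph.fromEdgeSet_empty
    have h : (openGraph ω).Reachable x y := hconn
    rw [hbot, SimpleGraph.reachable_bot] at h
    exact hxy h
  refine lt_of_lt_of_le ?_ (measureReal_mono hsub)
  rw [prodBernoulli_real_forall_notMem]
  exact Finset.prod_pos fun e _ => sub_pos.2 (hw e)

/-- **The single-finger bound when the separation event is non-null.**  Under terminal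
separation, if every `a ∈ A'` with `a ≠ b` has `μ(a ↮ b) ≤ t`, `0 ≤ t`, and the event `M` that
`insert b A'` is pairwise separated has `μ(M) > 0`, then
`μ{exactly one point of A' joined to o, o ↮ b} ≤ t`. -/
theorem singleFinger_le_of_pairSep_pos
    (hTS : ∀ (n : ℕ) (w : Sym2 (Fin n) → unitInterval) (T : Finset (Fin n)) (o a : Fin n),
      (prodBernoulli w).real (openConn o a ∩ {ω | ∀ t ∈ T, ω ∉ openConn a t}) *
        (prodBernoulli w).real ({ω | ∀ t ∈ T, ω ∉ openConn a t} ∩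
            {ω | ∀ t ∈ T, ∀ t' ∈ T, t ≠ t' → ω ∉ openConn t t'}) ≤
      (prodBernoulli w).real {ω | ∀ t ∈ T, ω ∉ openConn a t} *
        (prodBernoulli w).real (openConn o a ∩ ({ω | ∀ t ∈ T, ω ∉ openConn a t} ∩
              {ω | ∀ t ∈ T, ∀ t' ∈ T, t ≠ t' → ω ∉ openConn t t'})))
    {n : ℕ} (w : Sym2 (Fin n) → unitInterval) (A' : Finset (Fin n)) (o b : Fin n) (t : ℝ)
    (ht : 0 ≤ t)
    (hrel : ∀ a ∈ A'.filter (· ≠ b), (prodBernoulli w).real (openConn a b)ᶜ ≤ t)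
    (hM : 0 < (prodBernoulli w).real
      {ω : Set (Sym2 (Fin n)) | ∀ x ∈ insert b A', ∀ y ∈ insert b A', x ≠ y → ω ∉ openConn x y}) :
    (prodBernoulli w).real
        {ω : Set (Sym2 (Fin n)) |
          (A'.filter fun a => ω ∈ openConn o a).card = 1 ∧ ω ∉ openConn o b} ≤ t := by
  set μ := prodBernoulli w with hμ
  set G : Finset (Fin n) := insert b A' with hG
  set A'' : Finset (Fin n) := A'.filter (· ≠ b) with hA''
  set M : Set (Set (Sym2 (Fin n))) := {ω | ∀ x ∈ G, ∀ y ∈ G, x ≠ y → ω ∉ openConn x y} with hMdef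
  have hA''G : A'' ⊆ G := fun a ha => Finset.mem_insert_of_mem (Finset.mem_filter.1 ha).1
  -- (A1) cover and union bound
  have h1 : μ.real {ω : Set (Sym2 (Fin n)) |
        (A'.filter fun a => ω ∈ openConn o a).card = 1 ∧ ω ∉ openConn o b} ≤
      ∑ a ∈ A'', μ.real (openConn o a ∩ {ω | ∀ t ∈ G.erase a, ω ∉ openConn a t}) :=
    (measureReal_mono (singleFinger_subset_biUnion A' o b) (measure_ne_top _ _)).trans
      (measureReal_biUnion_finset_le A'' _)
  -- (A2) terminal separation, term by term
  have h2 : ∀ a ∈ A'',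
      μ.real (openConn o a ∩ {ω | ∀ t ∈ G.erase a, ω ∉ openConn a t}) * μ.real M ≤
        t * μ.real (openConn o a ∩ M) := by
    intro a ha
    obtain ⟨haA, hab⟩ := Finset.mem_filter.1 ha
    have key := hTS n w (G.erase a) o a
    rw [singleFinger_sep_inter_pairSep_eq G (hA''G ha)] at key
    refine key.trans (mul_le_mul_of_nonneg_right ?_ measureReal_nonneg)
    calc μ.real {ω | ∀ t ∈ G.erase a, ω ∉ openConn a t}
        ≤ μ.real (openConn a b)ᶜ :=
          measureReal_mono fun ω hω =>
            hω b (Finset.mem_erase.2 ⟨hab.symm, Finset.mem_insert_self b A'⟩)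
      _ ≤ t := hrel a ha
  -- (A3) disjointness of the events `{o ↔ a} ∩ M`
  have h3 : ∑ a ∈ A'', μ.real (openConn o a ∩ M) ≤ μ.real M := by
    rw [← measureReal_biUnion_finset
      (singleFinger_pairwiseDisjoint_conn_inter_pairSep G A'' o hA''G)
      (fun a _ => MeasurableSet.of_discrete)]
    exact measureReal_mono (Set.iUnion₂_subset fun a _ => Set.inter_subset_right)
  -- (A4) sum and divide by `μ(M) > 0`
  have h4 : (∑ a ∈ A'', μ.real (openConn o a ∩ {ω | ∀ t ∈ G.erase a, ω ∉ openConn a t})) *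
      μ.real M ≤ t * μ.real M := by
    rw [Finset.sum_mul]
    calc ∑ a ∈ A'', μ.real (openConn o a ∩ {ω | ∀ t ∈ G.erase a, ω ∉ openConn a t}) * μ.real M
        ≤ ∑ a ∈ A'', t * μ.real (openConn o a ∩ M) := Finset.sum_le_sum h2
      _ = t * ∑ a ∈ A'', μ.real (openConn o a ∩ M) := (Finset.mul_sum _ _ _).symm
      _ ≤ t * μ.real M := mul_le_mul_of_nonneg_left h3 ht
  exact h1.trans (le_of_mul_le_mul_right h4 hM)

/-- **Single-finger lemma** (Kozma–Nitzan Lemma 2 with singleton blocks): given terminal separation and weight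
continuity, if every `a ∈ A'` has `μ(a ↮ b) ≤ t` then `μ{exactly one point of A' is joined to o, and o ↮ b} ≤ t`, with no
factor `|A'|`; see the module docstring. -/
theorem stub_singleFinger :
    (∀ (n : ℕ) (w : Sym2 (Fin n) → unitInterval) (T : Finset (Fin n)) (o a : Fin n),
      (Literature.Probability.LatticeModels.prodBernoulli w).real
          (Literature.Probability.Percolation.openConn o a ∩
            {ω | ∀ t ∈ T, ω ∉ Literature.Probability.Percolation.openConn a t}) *
        (Literature.Probability.LatticeModels.prodBernoulli w).real
          ({ω | ∀ t ∈ T, ω ∉ Literature.Probability.Percolation.openConn a t} ∩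
            {ω | ∀ t ∈ T, ∀ t' ∈ T, t ≠ t' → ω ∉ Literature.Probability.Percolation.openConn t t'}) ≤
      (Literature.Probability.LatticeModels.prodBernoulli w).real
          {ω | ∀ t ∈ T, ω ∉ Literature.Probability.Percolation.openConn a t} *
        (Literature.Probability.LatticeModels.prodBernoulli w).real
          (Literature.Probability.Percolation.openConn o a ∩
            ({ω | ∀ t ∈ T, ω ∉ Literature.Probability.Percolation.openConn a t} ∩
              {ω | ∀ t ∈ T, ∀ t' ∈ T, t ≠ t' → ω ∉ Literature.Probability.Percolation.openConn t t'}))) →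
    (∀ (n : ℕ) (E : Set (Literature.Probability.Percolation.BondConfig (Fin n))),
      Continuous fun w : Sym2 (Fin n) → unitInterval =>
        (Literature.Probability.LatticeModels.prodBernoulli w).real E) →
    ∀ (n : ℕ) (w : Sym2 (Fin n) → unitInterval) (A' : Finset (Fin n)) (o b : Fin n) (t : ℝ),
      0 ≤ t →
      (∀ a ∈ A', (Literature.Probability.LatticeModels.prodBernoulli w).real
          (Literature.Probability.Percolation.openConn a b)ᶜ ≤ t) →
      (Literature.Probability.LatticeModels.prodBernoulli w).real
          {ω | (A'.filter fun a => ω ∈ Literature.Probability.Percolation.openConn o a).card = 1 ∧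
            ω ∉ Literature.Probability.Percolation.openConn o b} ≤ t := by
  intro hTS hcont n w A' o b t ht hrel
  -- the scaled weights `w_k = (1 - 1/(k+1)) • w`, all `< 1`, converging to `w`
  have hcmem : ∀ k : ℕ, ((1 : ℝ) - 1 / ((k : ℝ) + 1)) ∈ unitInterval := by
    intro k
    have hk : (0 : ℝ) < (k : ℝ) + 1 := Nat.cast_add_one_pos k
    have h1 : 1 / ((k : ℝ) + 1) ≤ 1 := by
      rw [div_le_one hk]; linarith [(Nat.cast_nonneg k : (0 : ℝ) ≤ k)]
    have h0 : 0 ≤ 1 / ((k : ℝ) + 1) := by positivity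
    exact ⟨by linarith, by linarith⟩
  set wk : ℕ → Sym2 (Fin n) → unitInterval :=
    fun k e => ⟨(1 - 1 / ((k : ℝ) + 1)) * (w e : ℝ), unitInterval.mul_mem (hcmem k) (w e).2⟩
    with hwk_def
  have hwk_lt : ∀ k e, ((wk k e : unitInterval) : ℝ) < 1 := by
    intro k e
    have hk : (0 : ℝ) < (k : ℝ) + 1 := Nat.cast_add_one_pos k
    have hc : (1 : ℝ) - 1 / ((k : ℝ) + 1) < 1 := by
      have : 0 < 1 / ((k : ℝ) + 1) := by positivity
      linarith
    calc ((wk k e : unitInterval) : ℝ) = (1 - 1 / ((k : ℝ) + 1)) * (w e : ℝ) := rfl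
      _ ≤ (1 - 1 / ((k : ℝ) + 1)) := mul_le_of_le_one_right (hcmem k).1 (w e).2.2
      _ < 1 := hc
  have hc_lim : Tendsto (fun k : ℕ => (1 : ℝ) - 1 / ((k : ℝ) + 1)) atTop (𝓝 1) := by
    simpa using tendsto_const_nhds.sub (tendsto_one_div_add_atTop_nhds_zero_nat (𝕜 := ℝ))
  have hwk_lim : Tendsto wk atTop (𝓝 w) := by
    refine tendsto_pi_nhds.2 fun e => ?_
    rw [tendsto_subtype_rng]
    have h := hc_lim.mul_const (w e : ℝ)
    rw [one_mul] at h
    exact h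
  have hlimE : ∀ E : Set (Set (Sym2 (Fin n))),
      Tendsto (fun k => (prodBernoulli (wk k)).real E) atTop (𝓝 ((prodBernoulli w).real E)) :=
    fun E => ((hcont n E).tendsto w).comp hwk_lim
  -- the error terms `δ k = ∑_{a ∈ A''} |μ_{w_k}(a ↮ b) - μ_w(a ↮ b)| → 0`
  set A'' : Finset (Fin n) := A'.filter (· ≠ b) with hA''
  set δ : ℕ → ℝ := fun k => ∑ a ∈ A'',
      |(prodBernoulli (wk k)).real (openConn a b)ᶜ - (prodBernoulli w).real (openConn a b)ᶜ|
    with hδ_def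
  have hδ0 : ∀ k, 0 ≤ δ k := fun k => Finset.sum_nonneg fun a _ => abs_nonneg _
  have hδ_lim : Tendsto δ atTop (𝓝 0) := by
    have h : ∀ a ∈ A'', Tendsto (fun k =>
        |(prodBernoulli (wk k)).real (openConn a b)ᶜ - (prodBernoulli w).real (openConn a b)ᶜ|)
        atTop (𝓝 0) := by
      intro a _
      simpa using (tendsto_sub_nhds_zero_iff.2 (hlimE (openConn a b)ᶜ)).abs
    simpa [hδ_def] using tendsto_finsetSum A'' h
  -- the bound at each `k` (all weights `< 1`, so the separation event is non-null)
  have hk : ∀ k, (prodBernoulli (wk k)).real {ω : Set (Sym2 (Fin n)) |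
      (A'.filter fun a => ω ∈ openConn o a).card = 1 ∧ ω ∉ openConn o b} ≤ t + δ k := by
    intro k
    refine singleFinger_le_of_pairSep_pos hTS (wk k) A' o b (t + δ k) (by linarith [hδ0 k]) ?_
      (singleFinger_pairSep_real_pos (wk k) (hwk_lt k) _)
    intro a ha
    have haA : a ∈ A' := (Finset.mem_filter.1 ha).1
    have h1 := hrel a haA
    have h2 : |(prodBernoulli (wk k)).real (openConn a b)ᶜ - (prodBernoulli w).real (openConn a b)ᶜ|
        ≤ δ k :=
      Finset.single_le_sum (f := fun a =>
        |(prodBernoulli (wk k)).real (openConn a b)ᶜ - (prodBernoulli w).real (openConn a b)ᶜ|)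
        (fun a _ => abs_nonneg _) ha
    have h3 := le_abs_self
      ((prodBernoulli (wk k)).real (openConn a b)ᶜ - (prodBernoulli w).real (openConn a b)ᶜ)
    linarith
  -- pass to the limit `k → ∞`
  have hlimt : Tendsto (fun k => t + δ k) atTop (𝓝 t) := by
    simpa using tendsto_const_nhds.add hδ_lim
  exact le_of_tendsto_of_tendsto' (hlimE _) hlimt hk

end Summit.CriticalPhenomena.PercolationContinuityZ3.Theorems
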